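import Mathlib
import Literature.Analysis.ODE.ParametricLinear

/-!
# Uniqueness of the smooth branch at a first-kind singular point with non-real exponent
# (crux `DenseExcursion`, line `sonic-cavity-renewal`, brick for stub `stub_cavityResolventCk`, theorem T2)

Helper file (`--supports stmt-AtomisticToContinuum-12586`, line lead a2, stub-worker W4 for `stub_cavityResolventCk`).
For the `2 × 2` first-kind singular system `x v′ = N(x) v` on `(−ρ, ρ)` with `N(0) = [[ν, β₀],[0, 0]]`, `Im ν ≠ 0`,
`Re ν ≤ k − 1`, suppose an ANALYTIC FROBENIUS PAIR is given: `φ₁ = (a₁, a₂)` solving `x φ₁′ = N φ₁` with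
`a₂(0) = 1`, and `ψ = (ψ₁, ψ₂)` solving `x ψ′ = (N − ν)ψ` with `ψ₁(0) = 1`, both smooth across `0`, with Wronskian
`w = a₁ψ₂ − a₂ψ₁ ≠ 0`. Then every solution `(p, q)` of class `C^∞` on `(−ρ, ρ)` with `q(0) = 0` vanishes identically
(registered helper `singular_branch_unique`). Mechanism: on `(0, ρ)` the system is regular, so `(p, q) = α φ₁ + β x^ν ψ`
(`Literature.Analysis.ODE.eqOn_of_hasDerivAt_linear`); if `β ≠ 0` then `x^ν = (p − α a₁)/(β ψ₁)` would be `C^∞`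
across `0`, but its `k`-th derivative `ν(ν−1)⋯(ν−k+1) x^{ν−k}` is unbounded as `x → 0⁺` (`Re ν − k ≤ −1`, no factor
vanishes as `Im ν ≠ 0`); so `β = 0`, then `q(0⁺) = α a₂(0) = α = 0`; the left side follows by the reflection `x ↦ −x`.
Sources: Coddington–Levinson 1955 Ch. 4 §§1–2 (folklore).
-/

noncomputable section

open Set Filter
open scoped Topology ContDiff

namespace Summit.AtomisticToContinuum.HydrodynamicLimit.Theorems.SonicCavityRenewal

open Literature.Analysis.ODE (eqOn_of_hasDerivAt_linear)

/-- For a chain of derivatives `F₀, …, F_L` on an open set, the iterated derivatives of `F₀` are the `Fⱼ` (local copy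
of the series-file lemma, to keep this file independent). [folklore] -/
theorem iteratedDeriv_eq_of_deriv_family' {s : Set ℝ} (hs : IsOpen s) (F : ℕ → ℝ → ℂ) (L : ℕ)
    (hF : ∀ j < L, ∀ x ∈ s, HasDerivAt (F j) (F (j + 1) x) x) : ∀ j ≤ L, EqOn (iteratedDeriv j (F 0)) (F j) s := by
  intro j
  induction j with
  | zero => intro _ x _; simp
  | succ j ih =>
    intro hj x hx
    have h1 : iteratedDeriv j (F 0) =ᶠ[𝓝 x] F j := Filter.eventuallyEq_of_mem (hs.mem_nhds hx) (ih (Nat.le_of_succ_le hj))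
    rw [iteratedDeriv_succ, h1.deriv_eq]
    exact (hF j (Nat.lt_of_succ_le hj) x hx).deriv

/-- THE POWER `x^ν` IS NOT SMOOTH AT `0⁺`: if `Im ν ≠ 0`, `Re ν ≤ k − 1`, and a function `e` of class `C^∞` on `(−ρ, ρ)`
agrees with `x ↦ x^ν` on `(0, ρ)`, contradiction (its `k`-th derivative is bounded near `0`, that of `x^ν` is not).
[folklore] -/
theorem not_contDiffOn_extension_cpow {ν : ℂ} {k : ℕ} {ρ : ℝ} (hν : ν.re ≤ (k : ℝ) - 1) (hνi : ν.im ≠ 0) (hρ : 0 < ρ)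
    {e : ℝ → ℂ} (he : ContDiffOn ℝ ∞ e (Ioo (-ρ) ρ)) (heq : ∀ x ∈ Ioo (0 : ℝ) ρ, e x = (x : ℂ) ^ ν) : False := by
  -- the chain of derivatives of `x^ν` on `(0, ρ)`
  set h : ℕ → ℝ → ℂ := fun m x => (∏ i ∈ Finset.range m, (ν - i)) * (x : ℂ) ^ (ν - m) with hh
  have hνm : ∀ m : ℕ, ν - m ≠ 0 := fun m H => hνi (by simpa using congrArg Complex.im H)
  have hder : ∀ m, ∀ x ∈ Ioo (0 : ℝ) ρ, HasDerivAt (h m) (h (m + 1) x) x := by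
    intro m x hx
    have h1 := (hasDerivAt_ofReal_cpow_const hx.1.ne' (hνm m)).const_mul (∏ i ∈ Finset.range m, (ν - i))
    refine h1.congr_deriv ?_
    simp only [hh, Finset.prod_range_succ, Nat.cast_succ]
    rw [show ν - (m : ℂ) - 1 = ν - (m + 1) by ring]; ring
  -- `iteratedDeriv k e = h k` on `(0, ρ)`
  have hopen : IsOpen (Ioo (0 : ℝ) ρ) := isOpen_Ioo
  have hIt : ∀ x ∈ Ioo (0 : ℝ) ρ, iteratedDeriv k e x = h k x := by
    intro x hx
    have h1 : e =ᶠ[𝓝 x] h 0 := by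
      filter_upwards [hopen.mem_nhds hx] with y hy
      rw [heq y hy]; simp [hh]
    rw [h1.iteratedDeriv_eq]
    exact iteratedDeriv_eq_of_deriv_family' hopen h k (fun j _ => hder j) k le_rfl hx
  -- `iteratedDeriv k e` is continuous at `0`, hence bounded near `0`
  have hU : IsOpen (Ioo (-ρ) ρ) := isOpen_Ioo
  have h0U : (0 : ℝ) ∈ Ioo (-ρ) ρ := ⟨by linarith, hρ⟩
  have hcont : ContinuousAt (iteratedDeriv k e) 0 := by
    have h1 : ContinuousOn (iteratedDerivWithin k e (Ioo (-ρ) ρ)) (Ioo (-ρ) ρ) :=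
      he.continuousOn_iteratedDerivWithin (by exact_mod_cast le_top) hU.uniqueDiffOn
    exact ((h1.congr fun y hy => (iteratedDerivWithin_of_isOpen hU hy).symm).continuousAt (hU.mem_nhds h0U))
  obtain ⟨δ, hδ, hbd⟩ : ∃ δ > 0, ∀ x : ℝ, |x| < δ → ‖iteratedDeriv k e x‖ ≤ ‖iteratedDeriv k e 0‖ + 1 := by
    have := Metric.continuousAt_iff.1 hcont 1 one_pos
    obtain ⟨δ, hδ, h1⟩ := this
    refine ⟨δ, hδ, fun x hx => ?_⟩
    have h2 := h1 (x := x) (by simpa [Real.dist_eq] using hx)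
    rw [dist_eq_norm] at h2
    linarith [norm_sub_norm_le (iteratedDeriv k e x) (iteratedDeriv k e 0)]
  -- but `‖h k x‖ = |Π| x^{Re ν − k} ≥ |Π|/x` blows up
  set P : ℂ := ∏ i ∈ Finset.range k, (ν - i) with hP
  have hP0 : P ≠ 0 := Finset.prod_ne_zero_iff.2 fun i _ => hνm i
  have hPpos : 0 < ‖P‖ := norm_pos_iff.2 hP0
  set Bd : ℝ := ‖iteratedDeriv k e 0‖ + 1 with hBd
  have hBd0 : 0 < Bd := by positivity
  -- a small point `x`
  obtain ⟨x, hx0, hxδ, hxρ, hx1, hxP⟩ : ∃ x : ℝ, 0 < x ∧ x < δ ∧ x < ρ ∧ x ≤ 1 ∧ x < ‖P‖ / Bd := by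
    refine ⟨min (min (δ / 2) (ρ / 2)) (min 1 (‖P‖ / Bd / 2)), ?_, ?_, ?_, ?_, ?_⟩
    · positivity
    · linarith [min_le_left (min (δ / 2) (ρ / 2)) (min 1 (‖P‖ / Bd / 2)), min_le_left (δ / 2) (ρ / 2)]
    · linarith [min_le_left (min (δ / 2) (ρ / 2)) (min 1 (‖P‖ / Bd / 2)), min_le_right (δ / 2) (ρ / 2)]
    · exact (min_le_right _ _).trans (min_le_left _ _)
    · have : 0 < ‖P‖ / Bd := by positivity
      linarith [min_le_right (min (δ / 2) (ρ / 2)) (min 1 (‖P‖ / Bd / 2)), min_le_right 1 (‖P‖ / Bd / 2)]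
  have hval : ‖h k x‖ = ‖P‖ * x ^ (ν.re - k) := by
    simp only [hh, ← hP, norm_mul, Complex.norm_cpow_eq_rpow_re_of_pos hx0, Complex.sub_re, Complex.natCast_re]
  have hlow : ‖P‖ / x ≤ ‖h k x‖ := by
    rw [hval, div_eq_mul_inv, ← Real.rpow_neg_one]
    exact mul_le_mul_of_nonneg_left (Real.rpow_le_rpow_of_exponent_ge hx0 hx1 (by linarith)) hPpos.le
  have hhigh : ‖h k x‖ ≤ Bd := by rw [← hIt x ⟨hx0, hxρ⟩]; exact hbd x (by rwa [abs_of_pos hx0])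
  have : ‖P‖ / x ≤ Bd := hlow.trans hhigh
  rw [div_le_iff₀ hx0] at this
  rw [lt_div_iff₀ hBd0] at hxP
  linarith [mul_comm Bd x]

/-- ONE-SIDED UNIQUENESS. Under the hypotheses of `singular_branch_unique` (all on `(−ρ, ρ)`), the solution vanishes on
`(0, ρ)`. [folklore] -/
theorem singular_branch_unique_right {ν : ℂ} {k : ℕ} {ρ : ℝ} {n₁₁ n₁₂ n₂₁ n₂₂ a₁ a₂ ψ₁ ψ₂ p q : ℝ → ℂ}
    (hν : ν.re ≤ (k : ℝ) - 1) (hνi : ν.im ≠ 0) (hρ : 0 < ρ)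
    (hn₁₁ : ContinuousOn n₁₁ (Ioo (-ρ) ρ)) (hn₁₂ : ContinuousOn n₁₂ (Ioo (-ρ) ρ)) (hn₂₁ : ContinuousOn n₂₁ (Ioo (-ρ) ρ))
    (hn₂₂ : ContinuousOn n₂₂ (Ioo (-ρ) ρ))
    (ha₁ : ContDiffOn ℝ ∞ a₁ (Ioo (-ρ) ρ)) (ha₂ : ContDiffOn ℝ ∞ a₂ (Ioo (-ρ) ρ)) (hψ₁ : ContDiffOn ℝ ∞ ψ₁ (Ioo (-ρ) ρ))
    (hψ₂ : ContDiffOn ℝ ∞ ψ₂ (Ioo (-ρ) ρ))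
    (hodeA : ∀ x ∈ Ioo (-ρ) ρ, (x : ℂ) * deriv a₁ x = n₁₁ x * a₁ x + n₁₂ x * a₂ x ∧
      (x : ℂ) * deriv a₂ x = n₂₁ x * a₁ x + n₂₂ x * a₂ x)
    (hodeΨ : ∀ x ∈ Ioo (-ρ) ρ, (x : ℂ) * deriv ψ₁ x = (n₁₁ x - ν) * ψ₁ x + n₁₂ x * ψ₂ x ∧
      (x : ℂ) * deriv ψ₂ x = n₂₁ x * ψ₁ x + (n₂₂ x - ν) * ψ₂ x)
    (ha₂0 : a₂ 0 = 1) (hψ₁0 : ψ₁ 0 = 1) (hw : ∀ x ∈ Ioo (-ρ) ρ, a₁ x * ψ₂ x - a₂ x * ψ₁ x ≠ 0)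
    (hp : ContDiffOn ℝ ∞ p (Ioo (-ρ) ρ)) (hq : ContDiffOn ℝ ∞ q (Ioo (-ρ) ρ))
    (hode : ∀ x ∈ Ioo (-ρ) ρ, (x : ℂ) * deriv p x = n₁₁ x * p x + n₁₂ x * q x ∧
      (x : ℂ) * deriv q x = n₂₁ x * p x + n₂₂ x * q x) (hq0 : q 0 = 0) :
    ∀ x ∈ Ioo (0 : ℝ) ρ, p x = 0 ∧ q x = 0 := by
  have hU : IsOpen (Ioo (-ρ) ρ) := isOpen_Ioo
  have h0U : (0 : ℝ) ∈ Ioo (-ρ) ρ := ⟨by linarith, hρ⟩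
  have hsub : Ioo (0 : ℝ) ρ ⊆ Ioo (-ρ) ρ := fun x hx => ⟨by linarith [hx.1], hx.2⟩
  have hdiff : ∀ {f : ℝ → ℂ}, ContDiffOn ℝ ∞ f (Ioo (-ρ) ρ) → ∀ x ∈ Ioo (-ρ) ρ, HasDerivAt f (deriv f x) x :=
    fun hf x hx => ((hf.differentiableOn (by simp)) x hx |>.differentiableAt (hU.mem_nhds hx)).hasDerivAt
  -- the normalised coefficient `B(x) = x⁻¹ N(x)` as an operator on `ℂ × ℂ`
  set L₁ : ℝ → (ℂ × ℂ →L[ℝ] ℂ) := fun x => n₁₁ x • ContinuousLinearMap.fst ℝ ℂ ℂ + n₁₂ x • ContinuousLinearMap.snd ℝ ℂ ℂ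
  set L₂ : ℝ → (ℂ × ℂ →L[ℝ] ℂ) := fun x => n₂₁ x • ContinuousLinearMap.fst ℝ ℂ ℂ + n₂₂ x • ContinuousLinearMap.snd ℝ ℂ ℂ
  set B : ℝ → (ℂ × ℂ →L[ℝ] ℂ × ℂ) := fun x =>
    (x⁻¹ : ℝ) • ((ContinuousLinearMap.inl ℝ ℂ ℂ).comp (L₁ x) + (ContinuousLinearMap.inr ℝ ℂ ℂ).comp (L₂ x)) with hB
  have hBapply : ∀ (x : ℝ) (u : ℂ × ℂ), B x u = ((x⁻¹ : ℝ) • (n₁₁ x * u.1 + n₁₂ x * u.2),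
      (x⁻¹ : ℝ) • (n₂₁ x * u.1 + n₂₂ x * u.2)) := by
    intro x u
    simp [hB, L₁, L₂]
  have hBcont : ContinuousOn B (Ioo 0 ρ) := by
    have hL₁ : ContinuousOn L₁ (Ioo 0 ρ) :=
      ((hn₁₁.mono hsub).smul continuousOn_const).add ((hn₁₂.mono hsub).smul continuousOn_const)
    have hL₂ : ContinuousOn L₂ (Ioo 0 ρ) :=
      ((hn₂₁.mono hsub).smul continuousOn_const).add ((hn₂₂.mono hsub).smul continuousOn_const)
    refine ContinuousOn.smul (continuousOn_inv₀.mono fun x hx => hx.1.ne') ?_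
    exact (continuousOn_const.clm_comp hL₁).add (continuousOn_const.clm_comp hL₂)
  -- a solution of `x v′ = N v` (components `f, g`) solves `v′ = B v` on `(0, ρ)`
  have hsol : ∀ {f g f' g' : ℝ → ℂ}, (∀ x ∈ Ioo (0 : ℝ) ρ, HasDerivAt f (f' x) x ∧ HasDerivAt g (g' x) x ∧
      (x : ℂ) * f' x = n₁₁ x * f x + n₁₂ x * g x ∧ (x : ℂ) * g' x = n₂₁ x * f x + n₂₂ x * g x) →
      ∀ x ∈ Ioo (0 : ℝ) ρ, HasDerivAt (fun y => (f y, g y)) (B x (f x, g x)) x := by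
    intro f g f' g' h x hx
    obtain ⟨hf, hg, e1, e2⟩ := h x hx
    have hx0 : (x : ℂ) ≠ 0 := Complex.ofReal_ne_zero.2 hx.1.ne'
    convert hf.prodMk hg using 1
    rw [hBapply]
    ext
    · simp only [Complex.real_smul, Complex.ofReal_inv]; field_simp; linear_combination -e1
    · simp only [Complex.real_smul, Complex.ofReal_inv]; field_simp; linear_combination -e2
  -- the three solutions: `d = (p, q)`, `φ₁ = (a₁, a₂)`, `Φ₂ = x^ν (ψ₁, ψ₂)`
  have hd : ∀ x ∈ Ioo (0 : ℝ) ρ, HasDerivAt (fun y => (p y, q y)) (B x (p x, q x)) x :=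
    hsol fun x hx => ⟨hdiff hp x (hsub hx), hdiff hq x (hsub hx), hode x (hsub hx)⟩
  have hφ : ∀ x ∈ Ioo (0 : ℝ) ρ, HasDerivAt (fun y => (a₁ y, a₂ y)) (B x (a₁ x, a₂ x)) x :=
    hsol fun x hx => ⟨hdiff ha₁ x (hsub hx), hdiff ha₂ x (hsub hx), hodeA x (hsub hx)⟩
  set Φ₁ : ℝ → ℂ := fun x => (x : ℂ) ^ ν * ψ₁ x with hΦ₁
  set Φ₂ : ℝ → ℂ := fun x => (x : ℂ) ^ ν * ψ₂ x with hΦ₂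
  have hν0 : ν ≠ 0 := fun H => hνi (by simp [H])
  have hΦ : ∀ x ∈ Ioo (0 : ℝ) ρ, HasDerivAt (fun y => (Φ₁ y, Φ₂ y)) (B x (Φ₁ x, Φ₂ x)) x := by
    refine hsol (f' := fun x => ν * (x : ℂ) ^ (ν - 1) * ψ₁ x + (x : ℂ) ^ ν * deriv ψ₁ x)
      (g' := fun x => ν * (x : ℂ) ^ (ν - 1) * ψ₂ x + (x : ℂ) ^ ν * deriv ψ₂ x) fun x hx => ?_
    have hx0 : (x : ℂ) ≠ 0 := Complex.ofReal_ne_zero.2 hx.1.ne'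
    have hc := hasDerivAt_ofReal_cpow_const hx.1.ne' hν0
    obtain ⟨e1, e2⟩ := hodeΨ x (hsub hx)
    have hpow : (x : ℂ) * (x : ℂ) ^ (ν - 1) = (x : ℂ) ^ ν := by
      rw [Complex.cpow_sub _ _ hx0, Complex.cpow_one]; field_simp
    refine ⟨hc.mul (hdiff hψ₁ x (hsub hx)), hc.mul (hdiff hψ₂ x (hsub hx)), ?_, ?_⟩
    · simp only [hΦ₁, hΦ₂]
      linear_combination (ν * ψ₁ x) * hpow + (x : ℂ) ^ ν * e1
    · simp only [hΦ₁, hΦ₂]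
      linear_combination (ν * ψ₂ x) * hpow + (x : ℂ) ^ ν * e2
  -- solve for `α, β` at `x₀ = ρ/2`
  set x₀ : ℝ := ρ / 2 with hx₀
  have hx₀m : x₀ ∈ Ioo (0 : ℝ) ρ := ⟨by positivity, by linarith⟩
  have hx₀c : (x₀ : ℂ) ^ ν ≠ 0 := by
    rw [Ne, Complex.cpow_eq_zero_iff]; exact fun H => (Complex.ofReal_ne_zero.2 hx₀m.1.ne') H.1
  set Dt : ℂ := a₁ x₀ * Φ₂ x₀ - a₂ x₀ * Φ₁ x₀ with hDt
  have hDt0 : Dt ≠ 0 := by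
    have : Dt = (x₀ : ℂ) ^ ν * (a₁ x₀ * ψ₂ x₀ - a₂ x₀ * ψ₁ x₀) := by simp only [hDt, hΦ₁, hΦ₂]; ring
    rw [this]; exact mul_ne_zero hx₀c (hw x₀ (hsub hx₀m))
  set α : ℂ := (p x₀ * Φ₂ x₀ - q x₀ * Φ₁ x₀) / Dt with hα
  set β : ℂ := (a₁ x₀ * q x₀ - a₂ x₀ * p x₀) / Dt with hβ
  -- uniqueness of the regular linear ODE on `(0, ρ)`
  have hcomb : ∀ x ∈ Ioo (0 : ℝ) ρ, HasDerivAt (fun y => (α * a₁ y + β * Φ₁ y, α * a₂ y + β * Φ₂ y))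
      (B x (α * a₁ x + β * Φ₁ x, α * a₂ x + β * Φ₂ x)) x := by
    intro x hx
    have h1 := ((hφ x hx).fun_const_smul α).fun_add ((hΦ x hx).fun_const_smul β)
    have h2 : (fun y => (α * a₁ y + β * Φ₁ y, α * a₂ y + β * Φ₂ y)) =
        fun y => α • (a₁ y, a₂ y) + β • (Φ₁ y, Φ₂ y) := by
      funext y; ext <;> simp
    have h3 : B x (α * a₁ x + β * Φ₁ x, α * a₂ x + β * Φ₂ x) = α • B x (a₁ x, a₂ x) + β • B x (Φ₁ x, Φ₂ x) := by
      rw [hBapply, hBapply, hBapply]; ext <;> simp <;> ring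
    rw [h2, h3]; exact h1
  have hEq : EqOn (fun y => (p y, q y)) (fun y => (α * a₁ y + β * Φ₁ y, α * a₂ y + β * Φ₂ y)) (Ioo 0 ρ) := by
    refine eqOn_of_hasDerivAt_linear hx₀m hBcont hd hcomb ?_
    simp only [hα, hβ, Prod.mk.injEq]
    constructor
    · field_simp; simp only [hDt]; ring
    · field_simp; simp only [hDt]; ring
  have hpq : ∀ x ∈ Ioo (0 : ℝ) ρ, p x = α * a₁ x + β * Φ₁ x ∧ q x = α * a₂ x + β * Φ₂ x := fun x hx => by
    have := hEq hx; simp only [Prod.mk.injEq] at this; exact this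
  -- `β = 0`: otherwise `x^ν = (p − α a₁)/(β ψ₁)` would be smooth across `0`
  have hβ0 : β = 0 := by
    by_contra hβne
    -- a neighbourhood of `0` where `ψ₁ ≠ 0`
    have hψc : ContinuousAt ψ₁ 0 := (hψ₁.continuousOn.continuousWithinAt h0U).continuousAt (hU.mem_nhds h0U)
    obtain ⟨δ, hδ, hδψ⟩ : ∃ δ > 0, ∀ x : ℝ, |x| < δ → ψ₁ x ≠ 0 := by
      obtain ⟨δ, hδ, h1⟩ := Metric.continuousAt_iff.1 hψc (1 / 2) (by norm_num)
      refine ⟨δ, hδ, fun x hx H => ?_⟩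
      have h2 := h1 (x := x) (by simpa [Real.dist_eq] using hx)
      rw [H, hψ₁0, dist_eq_norm] at h2; norm_num at h2
    set ρ' : ℝ := min δ ρ with hρ'
    have hρ'0 : 0 < ρ' := lt_min hδ hρ
    have hsub' : Ioo (-ρ') ρ' ⊆ Ioo (-ρ) ρ := fun x hx =>
      ⟨by linarith [hx.1, min_le_right δ ρ], hx.2.trans_le (min_le_right _ _)⟩
    have hψne : ∀ x ∈ Ioo (-ρ') ρ', β * ψ₁ x ≠ 0 := fun x hx =>
      mul_ne_zero hβne (hδψ x ((abs_lt.2 hx).trans_le (min_le_left _ _)))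
    refine not_contDiffOn_extension_cpow hν hνi hρ'0 (e := fun x => (p x - α * a₁ x) * (β * ψ₁ x)⁻¹) ?_ ?_
    · exact ((hp.mono hsub').sub (contDiffOn_const.mul (ha₁.mono hsub'))).mul
        ((contDiffOn_const.mul (hψ₁.mono hsub')).inv hψne)
    · intro x hx
      have hx' : x ∈ Ioo (0 : ℝ) ρ := ⟨hx.1, hx.2.trans_le (min_le_right _ _)⟩
      rw [(hpq x hx').1, ← div_eq_mul_inv, div_eq_iff (hψne x ⟨by linarith [hx.1], hx.2⟩)]
      simp only [hΦ₁]; ring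
  -- `α = 0`: `q − α a₂` vanishes on `(0, ρ)` and is continuous at `0`, where it equals `−α`
  have hα0 : α = 0 := by
    have hc : ContinuousAt (fun y => q y - α * a₂ y) 0 :=
      ((hq.continuousOn.continuousWithinAt h0U).continuousAt (hU.mem_nhds h0U)).sub
        (((ha₂.continuousOn.continuousWithinAt h0U).continuousAt (hU.mem_nhds h0U)).const_smul α)
    have h1 : Tendsto (fun y => q y - α * a₂ y) (𝓝[>] 0) (𝓝 (q 0 - α * a₂ 0)) := hc.tendsto.mono_left nhdsWithin_le_nhds
    have h2 : Tendsto (fun y => q y - α * a₂ y) (𝓝[>] 0) (𝓝 0) := by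
      refine tendsto_const_nhds.congr' ?_
      filter_upwards [Ioo_mem_nhdsGT hρ] with y hy
      rw [(hpq y hy).2, hβ0]; ring
    have := tendsto_nhds_unique h1 h2
    rw [hq0, ha₂0] at this
    linear_combination -this
  intro x hx
  obtain ⟨e1, e2⟩ := hpq x hx
  rw [hα0, hβ0] at e1 e2
  exact ⟨by rw [e1]; ring, by rw [e2]; ring⟩

/-- **Registered helper `singular_branch_unique`: UNIQUENESS OF THE SMOOTH BRANCH AT A FIRST-KIND SINGULAR POINT.**
For `x v′ = N(x)v` on `(−ρ, ρ)` with continuous coefficients, `N₁₁(0) = ν`, `Im ν ≠ 0`, `Re ν ≤ k − 1`, given a smooth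
Frobenius pair `(a₁, a₂)` (exponent `0`, `a₂(0) = 1`) and `(ψ₁, ψ₂)` (exponent `ν`, `ψ₁(0) = 1`) with non-vanishing
Wronskian `a₁ψ₂ − a₂ψ₁`, every `C^∞` solution `(p, q)` on `(−ρ, ρ)` with `q(0) = 0` is identically zero. [folklore] -/
theorem singular_branch_unique : ∀ (ν : ℂ) (k : ℕ) (ρ : ℝ) (n₁₁ n₁₂ n₂₁ n₂₂ a₁ a₂ ψ₁ ψ₂ p q : ℝ → ℂ), ν.re ≤ (k : ℝ) - 1 → ν.im ≠ 0 → 0 < ρ → ContinuousOn n₁₁ (Set.Ioo (-ρ) ρ) → ContinuousOn n₁₂ (Set.Ioo (-ρ) ρ) → ContinuousOn n₂₁ (Set.Ioo (-ρ) ρ) → ContinuousOn n₂₂ (Set.Ioo (-ρ) ρ) → n₁₁ 0 = ν → ContDiffOn ℝ ∞ a₁ (Set.Ioo (-ρ) ρ) → ContDiffOn ℝ ∞ a₂ (Set.Ioo (-ρ) ρ) → ContDiffOn ℝ ∞ ψ₁ (Set.Ioo (-ρ) ρ) → ContDiffOn ℝ ∞ ψ₂ (Set.Ioo (-ρ) ρ)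 → (∀ x ∈ Set.Ioo (-ρ) ρ, (x : ℂ) * deriv a₁ x = n₁₁ x * a₁ x + n₁₂ x * a₂ x ∧ (x : ℂ) * deriv a₂ x = n₂₁ x * a₁ x + n₂₂ x * a₂ x) → (∀ x ∈ Set.Ioo (-ρ) ρ, (x : ℂ) * deriv ψ₁ x = (n₁₁ x - ν) * ψ₁ x + n₁₂ x * ψ₂ x ∧ (x : ℂ) * deriv ψ₂ x = n₂₁ x * ψ₁ x + (n₂₂ x - ν) * ψ₂ x) → a₂ 0 = 1 → ψ₁ 0 = 1 → (∀ x ∈ Set.Ioo (-ρ) ρ, a₁ x * ψ₂ x - a₂ x * ψ₁ x ≠ 0) → ContDiffOn ℝ ∞ p (Set.Ioo (-ρ) ρ) → ContDiffOn ℝ ∞ q (Set.Ioo (-ρ) ρ) → (∀ x ∈ Set.Ioo (-ρ) ρ, (x : ℂ) * deriv p x = n₁₁ x * p x + n₁₂ x * q x ∧ (x : ℂ) * deriv q x = n₂₁ x * p x + n₂₂ x * q x) → q 0 = 0 → ∀ x ∈ Set.Ioo (-ρ) ρ, p x = 0 ∧ q x = 0 := by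
  intro ν k ρ n₁₁ n₁₂ n₂₁ n₂₂ a₁ a₂ ψ₁ ψ₂ p q hν hνi hρ hn₁₁ hn₁₂ hn₂₁ hn₂₂ hn0 ha₁ ha₂ hψ₁ hψ₂ hodeA hodeΨ ha₂0 hψ₁0
    hw hp hq hode hq0
  have hU : IsOpen (Ioo (-ρ) ρ) := isOpen_Ioo
  have h0U : (0 : ℝ) ∈ Ioo (-ρ) ρ := ⟨by linarith, hρ⟩
  -- at `0`: `0 = ν p(0)`
  have hp0 : p 0 = 0 := by
    have := (hode 0 h0U).1
    rw [hq0, hn0, Complex.ofReal_zero, zero_mul, mul_zero, add_zero] at this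
    exact (mul_eq_zero.1 this.symm).resolve_left fun H => hνi (by simp [H])
  -- the right side
  have hright := singular_branch_unique_right hν hνi hρ hn₁₁ hn₁₂ hn₂₁ hn₂₂ ha₁ ha₂ hψ₁ hψ₂ hodeA hodeΨ ha₂0 hψ₁0 hw hp
    hq hode hq0
  -- the left side, by reflection `x ↦ −x`
  have hrefl : ∀ x : ℝ, x ∈ Ioo (-ρ) ρ → -x ∈ Ioo (-ρ) ρ := fun x hx => ⟨by linarith [hx.2], by linarith [hx.1]⟩
  have hmaps : MapsTo (fun x : ℝ => -x) (Ioo (-ρ) ρ) (Ioo (-ρ) ρ) := fun x hx => hrefl x hx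
  have hcR : ∀ {f : ℝ → ℂ}, ContDiffOn ℝ ∞ f (Ioo (-ρ) ρ) → ContDiffOn ℝ ∞ (fun y => f (-y)) (Ioo (-ρ) ρ) :=
    fun hf => hf.comp contDiff_neg.contDiffOn hmaps
  have hcR' : ∀ {f : ℝ → ℂ}, ContinuousOn f (Ioo (-ρ) ρ) → ContinuousOn (fun y => f (-y)) (Ioo (-ρ) ρ) :=
    fun hf => hf.comp continuousOn_neg hmaps
  have hdR : ∀ (f : ℝ → ℂ) (y : ℝ), (y : ℂ) * deriv (fun z => f (-z)) y = ((-y : ℝ) : ℂ) * deriv f (-y) := by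
    intro f y; rw [deriv_comp_neg]; push_cast; ring
  have hleft := singular_branch_unique_right (ν := ν) (k := k) (ρ := ρ) (n₁₁ := fun y => n₁₁ (-y))
    (n₁₂ := fun y => n₁₂ (-y)) (n₂₁ := fun y => n₂₁ (-y)) (n₂₂ := fun y => n₂₂ (-y)) (a₁ := fun y => a₁ (-y))
    (a₂ := fun y => a₂ (-y)) (ψ₁ := fun y => ψ₁ (-y)) (ψ₂ := fun y => ψ₂ (-y)) (p := fun y => p (-y))
    (q := fun y => q (-y)) hν hνi hρ (hcR' hn₁₁) (hcR' hn₁₂) (hcR' hn₂₁) (hcR' hn₂₂) (hcR ha₁) (hcR ha₂) (hcR hψ₁)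
    (hcR hψ₂) (fun y hy => by rw [hdR, hdR]; exact hodeA (-y) (hrefl y hy))
    (fun y hy => by rw [hdR, hdR]; exact hodeΨ (-y) (hrefl y hy)) (by simpa using ha₂0) (by simpa using hψ₁0)
    (fun y hy => hw (-y) (hrefl y hy)) (hcR hp) (hcR hq) (fun y hy => by rw [hdR, hdR]; exact hode (-y) (hrefl y hy))
    (by simpa using hq0)
  intro x hx
  rcases lt_trichotomy x 0 with h | rfl | h
  · have := hleft (-x) ⟨by linarith, by linarith [hx.1]⟩
    simpa using this
  · exact ⟨hp0, hq0⟩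
  · exact hright x ⟨h, hx.2⟩

end Summit.AtomisticToContinuum.HydrodynamicLimit.Theorems.SonicCavityRenewal

end
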